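import Mathlib.Algebra.Group.ForwardDiff
import Mathlib.NumberTheory.Bernoulli
import Mathlib.RingTheory.PowerSeries.Trunc
import Mathlib.Analysis.Complex.Exponential
import Mathlib.Analysis.SpecialFunctions.Trigonometric.Deriv
import Literature.NumberTheory.LFunctions.ZetaHeatExpansion
import HarnessLib

/-!
# Connes 2024, *Heat expansion and zeta*, Lemma 3.1: the Taylor expansion of
# `r(u) = e^{u/2}/(e^u − e^{−u}) − 1/(2u)` in Bernoulli and Euler numbers (PROVED, all orders, with remainder)

LABEL (line 1): RH-FREE elementary analysis (hyperbolic functions, Bernoulli and Euler numbers); part (B) of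
the discharge of the named fact `Literature.NumberTheory.LFunctions.Connes2024_heat_thm_1_1`
(`ZetaHeatExpansion.lean`, Connes 2024 Thm 1.1 = Connes 2026 Letter Thm 7.3, CONDITIONAL ON RH as printed).
Cell `rh-crit`, sub-cell `cc/`, row O1.  bears_on: W-C/W-P (C1) record only.  WHAT THIS IS NOT: anything
bearing on the truth of RH; nothing here mentions `ζ`.

Source: A. Connes, *Heat expansion and zeta*, Ann. Funct. Anal. 15 (2024), Paper No. 59 = arXiv:2402.13082
[bib `Connes2024HeatExpansion`; held text `paper:arxiv-2402.13082`, chunk locators `pNNNN:Lnn`], §3,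
**Lemma 3.1** (p0006:L1–L8): "One has the power series expansion, converging for `|u| < π`,
`r(u) = e^{u/2}/(e^u − e^{−u}) − 1/(2u) = Σ_0^∞ b_n u^n`, where `b_0 = ¼` and
`b_{2k−1} = −(1 − 2^{1−2k}) B_{2k}/(2(2k)!)`, `b_{2k} = ¼ 2^{−2k} E(2k)/(2k)!`", with the printed proof
"`e^{u/2}/(e^u − e^{−u}) = ½ (1/(e^{u/2} + e^{−u/2}) + 1/(e^{u/2} − e^{−u/2}))`", the Taylor expansions
"`2/(e^{u/2} + e^{−u/2}) = 1 + Σ E(2n)/(2n)! (u/2)^{2n}`" (Euler numbers, eq. (1.2)) and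
"`2/(e^{u/2} − e^{−u/2}) = 2/u − Σ 2(2^{2k−1} − 1)B_{2k}/(2k)! (u/2)^{2k−1}`" (Bernoulli numbers).

## What is proved (theorems only; no definition, no named fact)

The tree's `heatCoeffB n` (`ZetaHeatExpansion.lean`) IS the printed `b_n`, with `E(2n) = connesEuler n` given by
the printed double sum (1.2) and Mathlib's `bernoulli`.  We prove Lemma 3.1 in the form in which the proof of
Lemma 3.2 uses it (an asymptotic expansion at `u = 0` to every order, with an explicit-constant remainder):

* `ZetaHeatKernelTaylor.abs_heatKernel_sub_sum_le` — `∀ N ∃ C ∀ u ∈ (0,1], |r(u) − Σ_{n<N} b_n u^n| ≤ C u^N`;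
* `ZetaHeatKernelTaylor.abs_heatKernel_sub_sum_le_of_pos` — the same on all of `(0, ∞)` (on `[1, ∞)` both `r`
  and the Taylor polynomial are `O(u^N)`), which is the remainder estimate of Lemma 3.2's proof
  ("`|R^{(n)}(v)| ≤ c_n` … gives the required bound for the remainder", p0007).

Road (the printed one, made finitary).  `r(u) = ¼·sech(u/2) + ¼·(csch(u/2) − 2/u)`
(`heatKernel_eq_quarter`).  (i) **`sech`** (`abs_two_div_exp_add_exp_neg_sub_le`): `1/cosh v = 1/(1+c)`,
`c = cosh v − 1 = (e^{v/2} − e^{−v/2})²/2 ∈ [0, v²]`; the finite geometric series in `c`, the binomial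
expansion `c^k = 2^{−k} Σ_i (−1)^i C(2k,i) e^{(i−k)v}` (`cosh_sub_one_pow_eq_sum`) and the Taylor polynomials
of the exponentials (Mathlib `Complex.exp_bound'`) give `sech v = Σ_{j<J} A_j v^j/j! + O(v^J)` with
`A_j = Σ_{k≤J} (−½)^k Σ_i (−1)^i C(2k,i)(i−k)^j`; `A_{2n} = E(2n)` is exactly the printed double sum (1.2)
once the terms `k > 2n` are removed by the VANISHING OF CENTRAL DIFFERENCES `Σ_i (−1)^i C(2k,i)(i−k)^j = 0`,
`j < 2k` (Mathlib `fwdDiff_iter_pow_eq_zero_of_lt`; `sum_eq_connesEuler`), and `A_j = 0` for odd `j` by the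
reflection `i ↦ 2k − i` (`sum_eq_zero_of_odd`).  This is the generating-function proof of (1.2),
`sech v = Σ_k (−2 sinh²(v/2))^k`.  (ii) **`csch`** (`abs_two_div_exp_sub_exp_neg_sub_le`):
`1/sinh v = 2/(e^v − 1) − 2/(e^{2v} − 1)`, and for `β(w) = 1/(e^w − 1) − 1/w + ½` the identity
`w(e^w − 1)(β(w) − Σ_{2≤n≤M} B_n w^{n−1}/n!) = w − (e^w − 1)Σ_{n≤M} B_n w^n/n! = O(w^{M+2})`, the last step
being Mathlib's `bernoulliPowerSeries_mul_exp_sub_one` `(Σ B_n X^n/n!)(e^X − 1) = X` truncated to polynomials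
(`abs_sub_exp_sub_one_mul_bernoulli_sum_le`).  Deviation from print, declared: the source takes the two
classical Taylor series as known and (Lemma 3.2) estimates the remainder by Taylor's formula for
`R(u) = 2u r(u)`; here coefficients and remainder are obtained together from the finite identities above, which
is what a self-contained kernel proof needs (Mathlib has no Euler numbers and no analytic generating functions for
`B_n`).
-/

noncomputable section

open Finset Real

namespace Literature.NumberTheory.LFunctions

namespace ZetaHeatKernelTaylor

/-! ## Combinatorics of the Euler-number double sum -/

/-- `(-1)^(2k-i) = (-1)^i` for `i ≤ 2k`. [folklore] -/
private theorem neg_one_pow_two_mul_sub {k i : ℕ} (hi : i ≤ 2 * k) :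
    ((-1 : ℝ)) ^ (2 * k - i) = (-1) ^ i := by
  have h : ((-1 : ℝ)) ^ (2 * k - i) * (-1) ^ i = 1 := by
    rw [← pow_add, Nat.sub_add_cancel hi, pow_mul]; norm_num
  have h2 : ((-1 : ℝ)) ^ i * (-1) ^ i = 1 := by
    rw [← mul_pow]; norm_num
  nlinarith [h, h2, sq_nonneg (((-1 : ℝ)) ^ (2 * k - i) - (-1) ^ i)]

/-- **Vanishing central differences**: `Σ_{i=0}^{2k} (-1)^i C(2k,i) (i - k)^j = 0` for `j < 2k`
(the `2k`-th forward difference of the polynomial `x^j` at `-k`; Mathlib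
`fwdDiff_iter_pow_eq_zero_of_lt`). [folklore] -/
private theorem sum_neg_one_pow_mul_choose_mul_pow_eq_zero {k j : ℕ} (h : j < 2 * k) :
    ∑ i ∈ range (2 * k + 1), (-1 : ℝ) ^ i * ((2 * k).choose i : ℝ) * ((i : ℝ) - k) ^ j = 0 := by
  have h0 := congr_fun (fwdDiff_iter_pow_eq_zero_of_lt (R := ℝ) h) (-(k : ℝ))
  rw [fwdDiff_iter_eq_sum_shift] at h0
  simp only [Pi.zero_apply, nsmul_eq_mul, mul_one, zsmul_eq_mul, Int.cast_mul,
    Int.cast_pow, Int.cast_neg, Int.cast_one, Int.cast_natCast] at h0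
  rw [← h0]
  refine sum_congr rfl fun i hi => ?_
  have hi' : i ≤ 2 * k := Nat.lt_succ_iff.mp (mem_range.mp hi)
  rw [neg_one_pow_two_mul_sub hi']
  ring

/-- **Parity**: `Σ_{i=0}^{2k} (-1)^i C(2k,i) (i - k)^j = 0` for odd `j` (reflection `i ↦ 2k - i`).
[folklore] -/
private theorem sum_neg_one_pow_mul_choose_mul_pow_eq_zero_of_odd (k : ℕ) {j : ℕ} (hj : Odd j) :
    ∑ i ∈ range (2 * k + 1), (-1 : ℝ) ^ i * ((2 * k).choose i : ℝ) * ((i : ℝ) - k) ^ j = 0 := by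
  set S := ∑ i ∈ range (2 * k + 1), (-1 : ℝ) ^ i * ((2 * k).choose i : ℝ) * ((i : ℝ) - k) ^ j
    with hS
  have hrefl := sum_range_reflect
    (fun i => (-1 : ℝ) ^ i * ((2 * k).choose i : ℝ) * ((i : ℝ) - k) ^ j) (2 * k + 1)
  have hneg : ∑ i ∈ range (2 * k + 1),
      (-1 : ℝ) ^ (2 * k + 1 - 1 - i) * ((2 * k).choose (2 * k + 1 - 1 - i) : ℝ) *
        (((2 * k + 1 - 1 - i : ℕ) : ℝ) - k) ^ j = -S := by
    rw [hS, ← sum_neg_distrib]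
    refine sum_congr rfl fun i hi => ?_
    have hi' : i ≤ 2 * k := Nat.lt_succ_iff.mp (mem_range.mp hi)
    have e1 : 2 * k + 1 - 1 - i = 2 * k - i := by omega
    rw [e1, neg_one_pow_two_mul_sub hi', Nat.choose_symm hi', Nat.cast_sub hi']
    have e2 : (((2 * k : ℕ) : ℝ) - i - k) ^ j = -(((i : ℝ) - k) ^ j) := by
      rw [← hj.neg_pow]; congr 1; push_cast; ring
    rw [e2]; ring
  have : S = -S := by rw [← hneg, hrefl]
  linarith

/-- The Euler-number double sum of `connesEuler`, extended to `k ≤ K` and to every exponent `j`: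
for even `j = 2n` with `2n ≤ K` it is `E(2n)`, the summands with `k = 0` (`n ≥ 1`) and `k > 2n`
vanishing. [cite: Connes2024HeatExpansion, eq. (1.2) (arXiv p0002:L16)] -/
theorem sum_eq_connesEuler {K n : ℕ} (hn : 2 * n ≤ K) :
    ∑ k ∈ range (K + 1), (-1 / 2 : ℝ) ^ k *
        ∑ i ∈ range (2 * k + 1), (-1 : ℝ) ^ i * ((2 * k).choose i : ℝ) * ((i : ℝ) - k) ^ (2 * n)
      = (connesEuler n : ℝ) := by
  rcases Nat.eq_zero_or_pos n with rfl | hnpos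
  · -- `n = 0`: only `k = 0` survives
    rw [connesEuler_zero, Rat.cast_one, sum_range_succ', sum_eq_zero]
    · simp
    · intro k _
      rw [sum_neg_one_pow_mul_choose_mul_pow_eq_zero (by omega), mul_zero]
  · rw [connesEuler, if_neg hnpos.ne']
    push_cast
    -- split `range (K+1)` as `{0} ∪ Icc 1 (2n) ∪ Icc (2n+1) K`
    have hsplit : range (K + 1) = {0} ∪ (Finset.Icc 1 (2 * n) ∪ Finset.Icc (2 * n + 1) K) := by
      ext k; simp only [mem_range, mem_union, mem_singleton, Finset.mem_Icc]; omega
    rw [hsplit, sum_union, sum_union, sum_singleton]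
    · -- the `k = 0` term and the `k > 2n` terms vanish
      have h0 : (-1 / 2 : ℝ) ^ 0 * ∑ i ∈ range (2 * 0 + 1),
          (-1 : ℝ) ^ i * ((2 * 0).choose i : ℝ) * ((i : ℝ) - (0 : ℕ)) ^ (2 * n) = 0 := by
        simp [zero_pow (by omega : 2 * n ≠ 0)]
      have h2 : ∑ k ∈ Finset.Icc (2 * n + 1) K, (-1 / 2 : ℝ) ^ k *
          ∑ i ∈ range (2 * k + 1), (-1 : ℝ) ^ i * ((2 * k).choose i : ℝ) * ((i : ℝ) - k) ^ (2 * n)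
            = 0 := by
        refine sum_eq_zero fun k hk => ?_
        rw [Finset.mem_Icc] at hk
        rw [sum_neg_one_pow_mul_choose_mul_pow_eq_zero (by omega), mul_zero]
      rw [h0, h2, zero_add, add_zero]
      refine sum_congr rfl fun k _ => ?_
      congr 1
      refine sum_congr rfl fun i _ => ?_
      rw [show ((k : ℝ) - i) ^ (2 * n) = ((i : ℝ) - k) ^ (2 * n) by
        rw [← neg_sub, Even.neg_pow ⟨n, two_mul n⟩]]
    · rw [Finset.disjoint_left]; intro k hk1 hk2
      rw [Finset.mem_Icc] at hk1 hk2; omega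
    · rw [Finset.disjoint_left]; intro k hk1 hk2
      rw [mem_singleton] at hk1; rw [mem_union, Finset.mem_Icc, Finset.mem_Icc] at hk2; omega

/-- Odd exponents: the extended double sum vanishes. [folklore] -/
private theorem sum_eq_zero_of_odd (K : ℕ) {j : ℕ} (hj : Odd j) :
    ∑ k ∈ range (K + 1), (-1 / 2 : ℝ) ^ k *
        ∑ i ∈ range (2 * k + 1), (-1 : ℝ) ^ i * ((2 * k).choose i : ℝ) * ((i : ℝ) - k) ^ j = 0 :=
  sum_eq_zero fun k _ => by rw [sum_neg_one_pow_mul_choose_mul_pow_eq_zero_of_odd k hj, mul_zero]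

/-! ## Taylor remainders of the exponential -/

/-- Real form of Mathlib's `Complex.exp_bound'`: `|e^x - Σ_{m<n} x^m/m!| ≤ 2|x|^n/n!` whenever
`|x| ≤ (n+1)/2`. [folklore] -/
private theorem abs_exp_sub_sum_le {x : ℝ} {n : ℕ} (hx : |x| ≤ ((n : ℝ) + 1) / 2) :
    |Real.exp x - ∑ m ∈ range n, x ^ m / m.factorial| ≤ 2 * |x| ^ n / n.factorial := by
  have hx' : ‖(x : ℂ)‖ / (n.succ : ℕ) ≤ 1 / 2 := by
    rw [Complex.norm_real, Real.norm_eq_abs, Nat.cast_succ, div_le_iff₀ (by positivity)]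
    linarith
  have h := Complex.exp_bound' hx'
  have e : Complex.exp (x : ℂ) - ∑ m ∈ range n, (x : ℂ) ^ m / (m.factorial : ℂ) =
      ((Real.exp x - ∑ m ∈ range n, x ^ m / m.factorial : ℝ) : ℂ) := by
    push_cast; rfl
  rw [e, Complex.norm_real, Real.norm_eq_abs, Complex.norm_real, Real.norm_eq_abs] at h
  rw [show 2 * |x| ^ n / (n.factorial : ℝ) = |x| ^ n / n.factorial * 2 by ring]
  exact h

/-- A polynomial is bounded on `[0, 1]` by the sum of the absolute values of its coefficients.
[folklore] -/
private theorem abs_eval_le_of_mem_Icc (s : Polynomial ℝ) {w : ℝ} (hw : w ∈ Set.Icc (0 : ℝ) 1) :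
    |s.eval w| ≤ ∑ i ∈ range (s.natDegree + 1), |s.coeff i| := by
  rw [Polynomial.eval_eq_sum_range]
  refine (abs_sum_le_sum_abs _ _).trans (sum_le_sum fun i _ => ?_)
  rw [abs_mul, abs_pow, abs_of_nonneg hw.1]
  exact mul_le_of_le_one_right (abs_nonneg _) (pow_le_one₀ hw.1 hw.2)

/-! ## The Bernoulli part: `w − (e^w − 1) Σ_{n ≤ M} B_n w^n/n! = O(w^{M+2})` -/

/-- **The Bernoulli generating function, truncated** (from Mathlib's
`bernoulliPowerSeries_mul_exp_sub_one : (Σ B_n X^n/n!)(e^X − 1) = X`): for every `M` there is `C` with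
`|w − (e^w − 1)·Σ_{n ≤ M} B_n w^n/n!| ≤ C w^{M+2}` on `[0, 1]`. [folklore] -/
private theorem abs_sub_exp_sub_one_mul_bernoulli_sum_le (M : ℕ) :
    ∃ C : ℝ, ∀ w ∈ Set.Icc (0 : ℝ) 1,
      |w - (Real.exp w - 1) * ∑ n ∈ range (M + 1), ((bernoulli n : ℚ) : ℝ) / n.factorial * w ^ n|
        ≤ C * w ^ (M + 2) := by
  classical
  -- the truncations
  set q : Polynomial ℝ := PowerSeries.trunc (M + 1) (bernoulliPowerSeries ℝ) with hq
  set p : Polynomial ℝ := PowerSeries.trunc (M + 2) (PowerSeries.exp ℝ - 1) with hp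
  -- low coefficients of `q * p` are those of `X`
  have hcoef : ∀ d < M + 2, (q * p - Polynomial.X).coeff d = 0 := by
    intro d hd
    have hfull := congr_arg (PowerSeries.coeff d)
      (bernoulliPowerSeries_mul_exp_sub_one (A := ℝ))
    rw [PowerSeries.coeff_mul] at hfull
    rw [Polynomial.coeff_sub, Polynomial.coeff_mul, Polynomial.coeff_X]
    have hsum : ∑ x ∈ antidiagonal d, q.coeff x.1 * p.coeff x.2 =
        ∑ x ∈ antidiagonal d, PowerSeries.coeff x.1 (bernoulliPowerSeries ℝ) *
          PowerSeries.coeff x.2 (PowerSeries.exp ℝ - 1) := by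
      refine sum_congr rfl fun x hx => ?_
      rw [Finset.HasAntidiagonal.mem_antidiagonal] at hx
      rw [hq, hp, PowerSeries.coeff_trunc, PowerSeries.coeff_trunc,
        if_pos (show x.2 < M + 2 by omega)]
      split_ifs with h1
      · rfl
      · have hx2 : x.2 = 0 := by omega
        simp [hx2]
    rw [hsum, hfull, PowerSeries.coeff_X]
    by_cases h1 : d = 1
    · subst h1; simp
    · rw [if_neg h1, if_neg (Ne.symm h1), sub_zero]
  obtain ⟨s, hs⟩ := Polynomial.X_pow_dvd_iff.mpr hcoef
  -- evaluations of the truncations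
  have hq_eval : ∀ w : ℝ, q.eval w =
      ∑ n ∈ range (M + 1), ((bernoulli n : ℚ) : ℝ) / n.factorial * w ^ n := by
    intro w
    rw [hq, PowerSeries.trunc_apply, Polynomial.eval_finsetSum, Nat.Ico_zero_eq_range]
    refine sum_congr rfl fun n _ => ?_
    rw [Polynomial.eval_monomial, bernoulliPowerSeries, PowerSeries.coeff_mk, eq_ratCast]
    push_cast
    ring
  have hp_eval : ∀ w : ℝ, p.eval w = ∑ m ∈ range (M + 2), w ^ m / m.factorial - 1 := by
    intro w
    rw [hp, PowerSeries.trunc_apply, Polynomial.eval_finsetSum, Nat.Ico_zero_eq_range]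
    have e : ∀ m : ℕ, Polynomial.eval w (Polynomial.monomial m
        (PowerSeries.coeff m (PowerSeries.exp ℝ - 1))) =
          w ^ m / (m.factorial : ℝ) - if m = 0 then (1 : ℝ) else 0 := by
      intro m
      rw [Polynomial.eval_monomial, map_sub, PowerSeries.coeff_exp, PowerSeries.coeff_one, eq_ratCast]
      split_ifs with hm
      · subst hm; simp
      · push_cast; ring
    simp only [e, sum_sub_distrib, sum_ite_eq', mem_range, if_pos (show 0 < M + 2 by omega)]
  -- constants
  set Cs : ℝ := ∑ i ∈ range (s.natDegree + 1), |s.coeff i| with hCs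
  set CQ : ℝ := ∑ n ∈ range (M + 1), |((bernoulli n : ℚ) : ℝ) / n.factorial| with hCQ
  refine ⟨Cs + 2 / ((M + 2).factorial : ℝ) * CQ, fun w hw => ?_⟩
  have hw0 : 0 ≤ w := hw.1
  -- the polynomial identity evaluated at `w`
  have hid : q.eval w * p.eval w - w = w ^ (M + 2) * s.eval w := by
    have := congr_arg (Polynomial.eval w) hs
    simpa [Polynomial.eval_sub, Polynomial.eval_mul, Polynomial.eval_pow, Polynomial.eval_X] using this
  -- the exponential remainder
  set ρ : ℝ := Real.exp w - ∑ m ∈ range (M + 2), w ^ m / m.factorial with hρ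
  have hρle : |ρ| ≤ 2 * w ^ (M + 2) / ((M + 2).factorial : ℝ) := by
    have h := abs_exp_sub_sum_le (x := w) (n := M + 2)
      (by rw [abs_of_nonneg hw0]; push_cast; linarith [hw.2, (Nat.cast_nonneg M : (0 : ℝ) ≤ M)])
    rwa [abs_of_nonneg hw0] at h
  have hQle : |∑ n ∈ range (M + 1), ((bernoulli n : ℚ) : ℝ) / n.factorial * w ^ n| ≤ CQ := by
    refine (abs_sum_le_sum_abs _ _).trans (sum_le_sum fun n _ => ?_)
    rw [abs_mul, abs_pow, abs_of_nonneg hw0]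
    exact mul_le_of_le_one_right (abs_nonneg _) (pow_le_one₀ hw0 hw.2)
  have hsle : |s.eval w| ≤ Cs := abs_eval_le_of_mem_Icc s hw
  -- assemble
  have key : w - (Real.exp w - 1) * ∑ n ∈ range (M + 1), ((bernoulli n : ℚ) : ℝ) / n.factorial * w ^ n
      = -(w ^ (M + 2) * s.eval w) -
        ρ * ∑ n ∈ range (M + 1), ((bernoulli n : ℚ) : ℝ) / n.factorial * w ^ n := by
    have e1 : Real.exp w - 1 = p.eval w + ρ := by rw [hp_eval, hρ]; ring
    rw [e1, ← hq_eval w, ← hid]; ring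
  rw [key]
  have hwpow : 0 ≤ w ^ (M + 2) := pow_nonneg hw0 _
  calc |-(w ^ (M + 2) * s.eval w) - ρ * ∑ n ∈ range (M + 1), ((bernoulli n : ℚ) : ℝ) / n.factorial * w ^ n|
      ≤ |w ^ (M + 2) * s.eval w| + |ρ * ∑ n ∈ range (M + 1), ((bernoulli n : ℚ) : ℝ) / n.factorial * w ^ n| := by
        rw [show ∀ A B : ℝ, -A - B = -(A + B) from fun A B => by ring, abs_neg]
        exact abs_add_le _ _
    _ = w ^ (M + 2) * |s.eval w| + |ρ| * |∑ n ∈ range (M + 1), ((bernoulli n : ℚ) : ℝ) / n.factorial * w ^ n| := by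
        rw [abs_mul, abs_mul, abs_of_nonneg hwpow]
    _ ≤ w ^ (M + 2) * Cs + (2 * w ^ (M + 2) / ((M + 2).factorial : ℝ)) * CQ := by
        gcongr
    _ = (Cs + 2 / ((M + 2).factorial : ℝ) * CQ) * w ^ (M + 2) := by ring

/-! ## `β(w) = 1/(e^w − 1) − 1/w + 1/2 = Σ_{1 ≤ m < M} B_{m+1} w^m/(m+1)! + O(w^M)` -/

/-- The regular part `β(w) = 1/(e^w − 1) − 1/w + 1/2` of `1/(e^w − 1)` at `0`:
`|β(w) − Σ_{1 ≤ m < M} B_{m+1} w^m/(m+1)!| ≤ C w^M` on `(0, 1]`, case `M ≥ 1`. [folklore] -/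
private theorem abs_inv_exp_sub_one_sub_le_of_pos {M : ℕ} (hM : 1 ≤ M) :
    ∃ C : ℝ, ∀ w ∈ Set.Ioc (0 : ℝ) 1,
      |1 / (Real.exp w - 1) - 1 / w + 1 / 2 -
          ∑ m ∈ Ico 1 M, ((bernoulli (m + 1) : ℚ) : ℝ) / (m + 1).factorial * w ^ m|
        ≤ C * w ^ M := by
  obtain ⟨C, hC⟩ := abs_sub_exp_sub_one_mul_bernoulli_sum_le M
  refine ⟨C, fun w hw => ?_⟩
  have hw0 : 0 < w := hw.1
  have hE : w ≤ Real.exp w - 1 := by linarith [Real.add_one_le_exp w]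
  have hE0 : 0 < Real.exp w - 1 := lt_of_lt_of_le hw0 hE
  set D : ℝ := w * (Real.exp w - 1) with hD
  have hD0 : 0 < D := mul_pos hw0 hE0
  have hDge : w ^ 2 ≤ D := by rw [hD, sq]; exact mul_le_mul_of_nonneg_left hE hw0.le
  -- the Bernoulli sum, split off `n = 0, 1`
  obtain ⟨M', rfl⟩ : ∃ M', M = M' + 1 := ⟨M - 1, by omega⟩
  have hQ : ∑ n ∈ range (M' + 1 + 1), ((bernoulli n : ℚ) : ℝ) / n.factorial * w ^ n =
      1 - w / 2 + ∑ m ∈ Ico 1 (M' + 1),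
        ((bernoulli (m + 1) : ℚ) : ℝ) / (m + 1).factorial * w ^ (m + 1) := by
    rw [sum_range_succ', sum_range_succ', Finset.sum_Ico_eq_sum_range, add_tsub_cancel_right,
      bernoulli_zero, zero_add, bernoulli_one]
    have e : ∑ i ∈ range M', ((bernoulli (i + 1 + 1) : ℚ) : ℝ) / (i + 1 + 1).factorial * w ^ (i + 1 + 1)
        = ∑ k ∈ range M', ((bernoulli (1 + k + 1) : ℚ) : ℝ) / (1 + k + 1).factorial * w ^ (1 + k + 1) :=
      sum_congr rfl fun i _ => by rw [add_comm 1 i]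
    rw [e]
    simp only [Nat.factorial_zero, Nat.factorial_one, Nat.cast_one, pow_zero, pow_one]
    push_cast
    ring
  -- the key identity `D · (β − Σ) = w − (e^w − 1) Q`
  have key : 1 / (Real.exp w - 1) - 1 / w + 1 / 2 -
      ∑ m ∈ Ico 1 (M' + 1), ((bernoulli (m + 1) : ℚ) : ℝ) / (m + 1).factorial * w ^ m
        = (w - (Real.exp w - 1) *
            ∑ n ∈ range (M' + 1 + 1), ((bernoulli n : ℚ) : ℝ) / n.factorial * w ^ n) / D := by
    rw [hQ, eq_div_iff hD0.ne', hD]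
    have e : ∑ m ∈ Ico 1 (M' + 1), ((bernoulli (m + 1) : ℚ) : ℝ) / (m + 1).factorial * w ^ (m + 1)
        = w * ∑ m ∈ Ico 1 (M' + 1), ((bernoulli (m + 1) : ℚ) : ℝ) / (m + 1).factorial * w ^ m := by
      rw [mul_sum]; refine sum_congr rfl fun m _ => ?_; ring
    rw [e]
    field_simp
    ring
  rw [key, abs_div, abs_of_pos hD0, div_le_iff₀ hD0]
  calc |w - (Real.exp w - 1) * ∑ n ∈ range (M' + 1 + 1), ((bernoulli n : ℚ) : ℝ) / n.factorial * w ^ n|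
      ≤ C * w ^ (M' + 1 + 2) := hC w ⟨hw0.le, hw.2⟩
    _ = C * w ^ (M' + 1) * w ^ 2 := by ring
    _ ≤ C * w ^ (M' + 1) * D := by
        have hC0 : 0 ≤ C := by
          have := (abs_nonneg _).trans (hC 1 ⟨zero_le_one, le_rfl⟩)
          simpa using this
        exact mul_le_mul_of_nonneg_left hDge (by positivity)

/-- `|β(w) − Σ_{1 ≤ m < M} B_{m+1} w^m/(m+1)!| ≤ C w^M` on `(0, 1]`, all `M`. [folklore] -/
private theorem abs_inv_exp_sub_one_sub_le (M : ℕ) :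
    ∃ C : ℝ, ∀ w ∈ Set.Ioc (0 : ℝ) 1,
      |1 / (Real.exp w - 1) - 1 / w + 1 / 2 -
          ∑ m ∈ Ico 1 M, ((bernoulli (m + 1) : ℚ) : ℝ) / (m + 1).factorial * w ^ m|
        ≤ C * w ^ M := by
  rcases Nat.eq_zero_or_pos M with rfl | hM
  · obtain ⟨C, hC⟩ := abs_inv_exp_sub_one_sub_le_of_pos le_rfl
    refine ⟨C, fun w hw => ?_⟩
    have h := hC w hw
    simp only [Finset.Ico_self, sum_empty, sub_zero, pow_one] at h
    simp only [show Ico 1 0 = ∅ by rfl, sum_empty, sub_zero, pow_zero, mul_one]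
    have hC0 : 0 ≤ C := by
      have := (abs_nonneg _).trans (hC 1 ⟨zero_lt_one, le_rfl⟩)
      simpa using this
    exact h.trans (mul_le_of_le_one_right hC0 hw.2)
  · exact abs_inv_exp_sub_one_sub_le_of_pos hM

/-! ## The hyperbolic cosecant: `2/(e^v − e^{−v}) − 1/v = Σ_{m<M} 2(1 − 2^m)B_{m+1} v^m/(m+1)! + O(v^M)` -/

/-- `2/(e^v − e^{−v}) = 2β(v) − 2β(2v) + 1/v` (i.e. `1/sinh v = 2/(e^v−1) − 2/(e^{2v}−1)`), `v ≠ 0`.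
[folklore] -/
private theorem two_div_exp_sub_exp_neg_eq {v : ℝ} (hv : 0 < v) :
    2 / (Real.exp v - Real.exp (-v)) - 1 / v =
      2 * (1 / (Real.exp v - 1) - 1 / v + 1 / 2) -
        2 * (1 / (Real.exp (2 * v) - 1) - 1 / (2 * v) + 1 / 2) := by
  rw [Real.exp_neg, show Real.exp (2 * v) = Real.exp v ^ 2 by rw [← Real.exp_nat_mul]; norm_num]
  set x := Real.exp v with hx
  have hx1 : 1 < x := by rw [hx]; exact Real.one_lt_exp_iff.mpr hv
  have hx0 : x ≠ 0 := by positivity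
  have h1 : x - 1 ≠ 0 := by linarith
  have h2 : x ^ 2 - 1 ≠ 0 := by nlinarith
  have h3 : x - x⁻¹ ≠ 0 := by
    have : x⁻¹ < 1 := inv_lt_one_of_one_lt₀ hx1
    linarith
  have hv' : v ≠ 0 := hv.ne'
  field_simp
  ring

/-- **Expansion of `1/sinh`**: `|2/(e^v − e^{−v}) − 1/v − Σ_{m<M} 2(1 − 2^m) B_{m+1} v^m/(m+1)!| ≤ C v^M`
on `(0, 1/2]` (the printed `2/(e^{u/2} − e^{−u/2}) = 2/u − Σ 2(2^{2k−1} − 1)B_{2k}/(2k)! (u/2)^{2k−1}`).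
[cite: Connes2024HeatExpansion, Lemma 3.1 proof, display for 2/(e^{u/2}−e^{−u/2}) (arXiv p0006:L18)] -/
theorem abs_two_div_exp_sub_exp_neg_sub_le (M : ℕ) :
    ∃ C : ℝ, ∀ v ∈ Set.Ioc (0 : ℝ) (1 / 2),
      |2 / (Real.exp v - Real.exp (-v)) - 1 / v -
          ∑ m ∈ range M, 2 * (1 - 2 ^ m) * ((bernoulli (m + 1) : ℚ) : ℝ) / (m + 1).factorial * v ^ m|
        ≤ C * v ^ M := by
  obtain ⟨C, hC⟩ := abs_inv_exp_sub_one_sub_le M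
  refine ⟨2 * C * (1 + 2 ^ M), fun v hv => ?_⟩
  have hv0 : 0 < v := hv.1
  have hv1 : v ∈ Set.Ioc (0 : ℝ) 1 := ⟨hv0, hv.2.trans (by norm_num)⟩
  have hv2 : 2 * v ∈ Set.Ioc (0 : ℝ) 1 := ⟨by linarith, by linarith [hv.2]⟩
  have h1 := hC v hv1
  have h2 := hC (2 * v) hv2
  -- drop the vanishing `m = 0` term and factor the sum
  have hsum : ∑ m ∈ range M, 2 * (1 - 2 ^ m) * ((bernoulli (m + 1) : ℚ) : ℝ) / (m + 1).factorial * v ^ m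
      = 2 * ∑ m ∈ Ico 1 M, ((bernoulli (m + 1) : ℚ) : ℝ) / (m + 1).factorial * v ^ m -
        2 * ∑ m ∈ Ico 1 M, ((bernoulli (m + 1) : ℚ) : ℝ) / (m + 1).factorial * (2 * v) ^ m := by
    rw [mul_sum, mul_sum, ← sum_sub_distrib, Finset.range_eq_Ico]
    rcases Nat.eq_zero_or_pos M with rfl | hM
    · simp
    · rw [Finset.sum_eq_sum_Ico_succ_bot hM]
      simp only [pow_zero, sub_self, mul_zero, zero_mul, zero_div, zero_add]
      refine sum_congr rfl fun m _ => ?_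
      rw [mul_pow]; ring
  rw [two_div_exp_sub_exp_neg_eq hv0, hsum]
  have e : 2 * (1 / (Real.exp v - 1) - 1 / v + 1 / 2) -
      2 * (1 / (Real.exp (2 * v) - 1) - 1 / (2 * v) + 1 / 2) -
      (2 * ∑ m ∈ Ico 1 M, ((bernoulli (m + 1) : ℚ) : ℝ) / (m + 1).factorial * v ^ m -
        2 * ∑ m ∈ Ico 1 M, ((bernoulli (m + 1) : ℚ) : ℝ) / (m + 1).factorial * (2 * v) ^ m)
      = 2 * (1 / (Real.exp v - 1) - 1 / v + 1 / 2 -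
          ∑ m ∈ Ico 1 M, ((bernoulli (m + 1) : ℚ) : ℝ) / (m + 1).factorial * v ^ m) -
        2 * (1 / (Real.exp (2 * v) - 1) - 1 / (2 * v) + 1 / 2 -
          ∑ m ∈ Ico 1 M, ((bernoulli (m + 1) : ℚ) : ℝ) / (m + 1).factorial * (2 * v) ^ m) := by
    ring
  rw [e]
  have hC0 : 0 ≤ C * v ^ M := (abs_nonneg _).trans h1
  calc |2 * (1 / (Real.exp v - 1) - 1 / v + 1 / 2 -
          ∑ m ∈ Ico 1 M, ((bernoulli (m + 1) : ℚ) : ℝ) / (m + 1).factorial * v ^ m) -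
        2 * (1 / (Real.exp (2 * v) - 1) - 1 / (2 * v) + 1 / 2 -
          ∑ m ∈ Ico 1 M, ((bernoulli (m + 1) : ℚ) : ℝ) / (m + 1).factorial * (2 * v) ^ m)|
      ≤ 2 * (C * v ^ M) + 2 * (C * (2 * v) ^ M) := by
        refine (abs_sub _ _).trans ?_
        rw [abs_mul, abs_mul, abs_two]
        gcongr
    _ = 2 * C * (1 + 2 ^ M) * v ^ M := by rw [mul_pow]; ring

/-! ## The hyperbolic secant: `2/(e^v + e^{−v}) = Σ_{2n<J} E(2n) v^{2n}/(2n)! + O(v^J)` -/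

/-- `(cosh v − 1)^k = 2^{−k} Σ_{i=0}^{2k} (−1)^i C(2k,i) e^{(i−k)v}` (from `cosh v − 1 = (e^{v/2} − e^{−v/2})²/2`
and the binomial theorem). [folklore] -/
private theorem cosh_sub_one_pow_eq_sum (v : ℝ) (k : ℕ) :
    ((Real.exp v + Real.exp (-v)) / 2 - 1) ^ k =
      (1 / 2 : ℝ) ^ k * ∑ i ∈ range (2 * k + 1),
        (-1 : ℝ) ^ i * ((2 * k).choose i : ℝ) * Real.exp (((i : ℝ) - k) * v) := by
  set a := Real.exp (v / 2) with ha
  set b := Real.exp (-(v / 2)) with hb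
  have hab : a * b = 1 := by rw [ha, hb, ← Real.exp_add]; simp
  have h2 : (Real.exp v + Real.exp (-v)) / 2 - 1 = (a - b) ^ 2 / 2 := by
    have ea : Real.exp v = a ^ 2 := by rw [ha, ← Real.exp_nat_mul]; ring_nf
    have eb : Real.exp (-v) = b ^ 2 := by rw [hb, ← Real.exp_nat_mul]; ring_nf
    rw [ea, eb]; nlinarith [hab]
  rw [h2, div_pow, ← pow_mul, show (1 / 2 : ℝ) ^ k * _ = _ * (1 / 2) ^ k from mul_comm _ _,
    div_eq_mul_one_div, one_div_pow]
  congr 1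
  rw [sub_eq_add_neg, add_pow, show 2 * k + 1 = 2 * k + 1 from rfl]
  refine sum_congr rfl fun i hi => ?_
  have hi' : i ≤ 2 * k := Nat.lt_succ_iff.mp (mem_range.mp hi)
  have epow : a ^ i * (-b) ^ (2 * k - i) = (-1) ^ i * Real.exp (((i : ℝ) - k) * v) := by
    rw [neg_pow, ha, hb, ← Real.exp_nat_mul, ← Real.exp_nat_mul]
    have hsign : ((-1 : ℝ)) ^ (2 * k - i) = (-1) ^ i := by
      have h : ((-1 : ℝ)) ^ (2 * k - i) * (-1) ^ i = 1 := by
        rw [← pow_add, Nat.sub_add_cancel hi', pow_mul]; norm_num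
      have h2 : ((-1 : ℝ)) ^ i * (-1) ^ i = 1 := by rw [← mul_pow]; norm_num
      nlinarith [h, h2, sq_nonneg (((-1 : ℝ)) ^ (2 * k - i) - (-1) ^ i)]
    rw [hsign, mul_left_comm, ← Real.exp_add, Nat.cast_sub hi']
    congr 1; congr 1; push_cast; ring
  rw [epow]; ring

/-- `0 ≤ cosh v − 1 ≤ v²` for `0 ≤ v ≤ 1` (`v ≤ sinh v` and `|e^v − 1 − v| ≤ v²`). [folklore] -/
private theorem cosh_sub_one_mem_Icc {v : ℝ} (hv0 : 0 ≤ v) (hv1 : v ≤ 1) :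
    0 ≤ (Real.exp v + Real.exp (-v)) / 2 - 1 ∧ (Real.exp v + Real.exp (-v)) / 2 - 1 ≤ v ^ 2 := by
  have hcosh : (Real.exp v + Real.exp (-v)) / 2 = Real.cosh v := (Real.cosh_eq v).symm
  refine ⟨by rw [hcosh]; linarith [Real.one_le_cosh v], ?_⟩
  have hs : v ≤ Real.sinh v := Real.self_le_sinh_iff.mpr hv0
  rw [Real.sinh_eq] at hs
  have he : Real.exp v - 1 - v ≤ v ^ 2 :=
    (le_abs_self _).trans (Real.abs_exp_sub_one_sub_id_le (by rwa [abs_of_nonneg hv0]))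
  linarith

/-- Finite geometric series with remainder: `1/(1+c) = Σ_{k<n} (−c)^k + (−c)^n/(1+c)` (`c ≥ 0`).
[folklore] -/
private theorem one_div_one_add_eq {c : ℝ} (hc : 0 ≤ c) (n : ℕ) :
    1 / (1 + c) = ∑ k ∈ range n, (-c) ^ k + (-c) ^ n / (1 + c) := by
  have h := mul_neg_geom_sum (-c) n
  rw [sub_neg_eq_add] at h
  have h1 : (1 + c) ≠ 0 := by positivity
  field_simp
  linarith [h]

/-- Rearrangement: `Σ_k a_k Σ_i b_{k,i} Σ_{j<J} (i−k)^j v^j/j! = Σ_{j<J} (Σ_k a_k Σ_i b_{k,i} (i−k)^j) v^j/j!`.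
[folklore] -/
private theorem sum_sum_sum_comm (K J : ℕ) (v : ℝ) :
    ∑ k ∈ range (K + 1), (-1 / 2 : ℝ) ^ k *
        ∑ i ∈ range (2 * k + 1), (-1 : ℝ) ^ i * ((2 * k).choose i : ℝ) *
          ∑ j ∈ range J, ((i : ℝ) - k) ^ j * v ^ j / j.factorial
      = ∑ j ∈ range J, (∑ k ∈ range (K + 1), (-1 / 2 : ℝ) ^ k *
          ∑ i ∈ range (2 * k + 1), (-1 : ℝ) ^ i * ((2 * k).choose i : ℝ) * ((i : ℝ) - k) ^ j) *
            v ^ j / j.factorial := by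
  set F : ℕ → ℕ → ℕ → ℝ := fun k i j =>
    (-1 / 2 : ℝ) ^ k * ((-1 : ℝ) ^ i * ((2 * k).choose i : ℝ) * (((i : ℝ) - k) ^ j * v ^ j / j.factorial))
    with hF
  calc ∑ k ∈ range (K + 1), (-1 / 2 : ℝ) ^ k *
        ∑ i ∈ range (2 * k + 1), (-1 : ℝ) ^ i * ((2 * k).choose i : ℝ) *
          ∑ j ∈ range J, ((i : ℝ) - k) ^ j * v ^ j / j.factorial
      = ∑ k ∈ range (K + 1), ∑ i ∈ range (2 * k + 1), ∑ j ∈ range J, F k i j := by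
        simp only [hF, mul_sum]
    _ = ∑ k ∈ range (K + 1), ∑ j ∈ range J, ∑ i ∈ range (2 * k + 1), F k i j :=
        sum_congr rfl fun k _ => sum_comm
    _ = ∑ j ∈ range J, ∑ k ∈ range (K + 1), ∑ i ∈ range (2 * k + 1), F k i j := sum_comm
    _ = _ := by
        simp only [hF, mul_sum, sum_mul, sum_div]
        exact sum_congr rfl fun j _ => sum_congr rfl fun k _ => sum_congr rfl fun i _ => by ring

/-- **Expansion of `1/cosh`**: for every `J` there is `C` with
`|2/(e^v + e^{−v}) − Σ_{j<J, j even} E(j) v^j/j!| ≤ C v^J` on `[0, 1/2]`, `E(2n) = connesEuler n` (the printed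
`2/(e^{u/2} + e^{−u/2}) = 1 + Σ E(2n)/(2n)! (u/2)^{2n}`; proof: geometric series in `cosh v − 1`, binomial
expansion, Taylor expansion of the exponentials, vanishing of central differences).
[cite: Connes2024HeatExpansion, Lemma 3.1 proof, display for 2/(e^{u/2}+e^{−u/2}) (arXiv p0006:L14)] -/
theorem abs_two_div_exp_add_exp_neg_sub_le (J : ℕ) :
    ∃ C : ℝ, ∀ v ∈ Set.Icc (0 : ℝ) (1 / 2),
      |2 / (Real.exp v + Real.exp (-v)) -
          ∑ j ∈ range J, (if Even j then ((connesEuler (j / 2) : ℚ) : ℝ) else 0) / j.factorial * v ^ j|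
        ≤ C * v ^ J := by
  set K := J with hK
  refine ⟨1 + ((K : ℝ) + 1) * 2 ^ K * (2 * (K : ℝ) ^ J / J.factorial), fun v hv => ?_⟩
  have hv0 : 0 ≤ v := hv.1
  have hv1 : v ≤ 1 := hv.2.trans (by norm_num)
  set c := (Real.exp v + Real.exp (-v)) / 2 - 1 with hc
  obtain ⟨hc0, hcv⟩ := cosh_sub_one_mem_Icc hv0 hv1
  have hsech : 2 / (Real.exp v + Real.exp (-v)) = 1 / (1 + c) := by
    rw [hc, show 1 + ((Real.exp v + Real.exp (-v)) / 2 - 1) = (Real.exp v + Real.exp (-v)) / 2 by ring,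
      one_div_div]
  -- Taylor remainders of the exponentials
  set ρ : ℕ → ℕ → ℝ := fun k i =>
    Real.exp (((i : ℝ) - k) * v) - ∑ j ∈ range J, (((i : ℝ) - k) * v) ^ j / j.factorial with hρ
  have hρle : ∀ k ∈ range (K + 1), ∀ i ∈ range (2 * k + 1),
      |ρ k i| ≤ 2 * ((K : ℝ) * v) ^ J / J.factorial := by
    intro k hk i hi
    have hk' : k ≤ K := Nat.lt_succ_iff.mp (mem_range.mp hk)
    have hi' : i ≤ 2 * k := Nat.lt_succ_iff.mp (mem_range.mp hi)
    have hik : |(i : ℝ) - k| ≤ K := by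
      rw [abs_le]; constructor
      · have : (0 : ℝ) ≤ i := Nat.cast_nonneg i
        have : (k : ℝ) ≤ K := by exact_mod_cast hk'
        linarith
      · have : (i : ℝ) ≤ 2 * k := by exact_mod_cast hi'
        have : (k : ℝ) ≤ K := by exact_mod_cast hk'
        linarith
    have hx : |((i : ℝ) - k) * v| ≤ ((J : ℝ) + 1) / 2 := by
      rw [abs_mul, abs_of_nonneg hv0]
      calc |(i : ℝ) - k| * v ≤ K * (1 / 2) := mul_le_mul hik hv.2 hv0 (Nat.cast_nonneg K)
        _ ≤ ((J : ℝ) + 1) / 2 := by rw [hK]; linarith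
    have h := abs_exp_sub_sum_le hx
    refine h.trans ?_
    rw [abs_mul, abs_of_nonneg hv0]
    gcongr
  -- the main decomposition
  have hmain : 1 / (1 + c) -
      ∑ j ∈ range J, (if Even j then ((connesEuler (j / 2) : ℚ) : ℝ) else 0) / j.factorial * v ^ j
        = (-c) ^ (K + 1) / (1 + c) +
          ∑ k ∈ range (K + 1), (-1 / 2 : ℝ) ^ k *
            ∑ i ∈ range (2 * k + 1), (-1 : ℝ) ^ i * ((2 * k).choose i : ℝ) * ρ k i := by
    -- expand `(-c)^k`
    have hck : ∀ k : ℕ, (-c) ^ k = (-1 / 2 : ℝ) ^ k * ∑ i ∈ range (2 * k + 1),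
        (-1 : ℝ) ^ i * ((2 * k).choose i : ℝ) * Real.exp (((i : ℝ) - k) * v) := by
      intro k
      rw [neg_pow, hc, cosh_sub_one_pow_eq_sum, ← mul_assoc, ← mul_pow]
      norm_num
    -- split `exp = Taylor + ρ`
    have hexp : ∀ k i : ℕ, Real.exp (((i : ℝ) - k) * v) =
        ∑ j ∈ range J, ((i : ℝ) - k) ^ j * v ^ j / j.factorial + ρ k i := by
      intro k i; rw [hρ]; simp only [mul_pow]; ring
    -- identify the coefficients
    have hcoef : ∀ j ∈ range J,
        (∑ k ∈ range (K + 1), (-1 / 2 : ℝ) ^ k *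
          ∑ i ∈ range (2 * k + 1), (-1 : ℝ) ^ i * ((2 * k).choose i : ℝ) * ((i : ℝ) - k) ^ j) *
            v ^ j / j.factorial
          = (if Even j then ((connesEuler (j / 2) : ℚ) : ℝ) else 0) / j.factorial * v ^ j := by
      intro j hj
      have hjK : j ≤ K := (mem_range.mp hj).le
      rcases Nat.even_or_odd j with ⟨n, hn⟩ | hodd
      · have hj2 : j = 2 * n := by omega
        rw [if_pos ⟨n, hn⟩, hj2, Nat.mul_div_cancel_left n two_pos,
          sum_eq_connesEuler (by omega)]
        ring
      · rw [if_neg (Nat.not_even_iff_odd.mpr hodd), sum_eq_zero_of_odd K hodd]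
        ring
    have hS : ∑ k ∈ range (K + 1), (-c) ^ k =
        ∑ j ∈ range J, (if Even j then ((connesEuler (j / 2) : ℚ) : ℝ) else 0) / j.factorial * v ^ j +
          ∑ k ∈ range (K + 1), (-1 / 2 : ℝ) ^ k *
            ∑ i ∈ range (2 * k + 1), (-1 : ℝ) ^ i * ((2 * k).choose i : ℝ) * ρ k i := by
      calc ∑ k ∈ range (K + 1), (-c) ^ k
          = ∑ k ∈ range (K + 1), (-1 / 2 : ℝ) ^ k * ∑ i ∈ range (2 * k + 1),
              (-1 : ℝ) ^ i * ((2 * k).choose i : ℝ) * Real.exp (((i : ℝ) - k) * v) :=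
            sum_congr rfl fun k _ => hck k
        _ = ∑ k ∈ range (K + 1), (-1 / 2 : ℝ) ^ k * ∑ i ∈ range (2 * k + 1),
              (-1 : ℝ) ^ i * ((2 * k).choose i : ℝ) *
                (∑ j ∈ range J, ((i : ℝ) - k) ^ j * v ^ j / j.factorial + ρ k i) := by
            simp only [← hexp]
        _ = ∑ k ∈ range (K + 1), (-1 / 2 : ℝ) ^ k * ∑ i ∈ range (2 * k + 1),
              (-1 : ℝ) ^ i * ((2 * k).choose i : ℝ) *
                ∑ j ∈ range J, ((i : ℝ) - k) ^ j * v ^ j / j.factorial +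
            ∑ k ∈ range (K + 1), (-1 / 2 : ℝ) ^ k *
              ∑ i ∈ range (2 * k + 1), (-1 : ℝ) ^ i * ((2 * k).choose i : ℝ) * ρ k i := by
            simp only [mul_add, sum_add_distrib]
        _ = _ := by rw [sum_sum_sum_comm K J v, sum_congr rfl hcoef]
    rw [one_div_one_add_eq hc0 (K + 1), hS]
    ring
  rw [hsech, hmain]
  -- estimates
  have htail : |(-c) ^ (K + 1) / (1 + c)| ≤ v ^ J := by
    rw [abs_div, abs_of_pos (by linarith : (0 : ℝ) < 1 + c), neg_pow, abs_mul,
      abs_pow, abs_pow, abs_neg, abs_one, one_pow, one_mul, abs_of_nonneg hc0]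
    calc c ^ (K + 1) / (1 + c) ≤ c ^ (K + 1) := div_le_self (pow_nonneg hc0 _) (by linarith)
      _ ≤ (v ^ 2) ^ (K + 1) := pow_le_pow_left₀ hc0 hcv _
      _ = v ^ (2 * K + 2) := by rw [← pow_mul]; ring_nf
      _ ≤ v ^ J := pow_le_pow_of_le_one hv0 hv1 (by omega)
  have hsumle : |∑ k ∈ range (K + 1), (-1 / 2 : ℝ) ^ k *
      ∑ i ∈ range (2 * k + 1), (-1 : ℝ) ^ i * ((2 * k).choose i : ℝ) * ρ k i|
        ≤ ((K : ℝ) + 1) * 2 ^ K * (2 * ((K : ℝ) * v) ^ J / J.factorial) := by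
    refine (abs_sum_le_sum_abs _ _).trans ?_
    have hterm : ∀ k ∈ range (K + 1), |(-1 / 2 : ℝ) ^ k *
        ∑ i ∈ range (2 * k + 1), (-1 : ℝ) ^ i * ((2 * k).choose i : ℝ) * ρ k i|
          ≤ 2 ^ K * (2 * ((K : ℝ) * v) ^ J / J.factorial) := by
      intro k hk
      have hk' : k ≤ K := Nat.lt_succ_iff.mp (mem_range.mp hk)
      rw [abs_mul, abs_pow, show |(-1 / 2 : ℝ)| = 1 / 2 by norm_num]
      have h1 : |∑ i ∈ range (2 * k + 1), (-1 : ℝ) ^ i * ((2 * k).choose i : ℝ) * ρ k i|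
          ≤ ∑ i ∈ range (2 * k + 1), ((2 * k).choose i : ℝ) * (2 * ((K : ℝ) * v) ^ J / J.factorial) := by
        refine (abs_sum_le_sum_abs _ _).trans (sum_le_sum fun i hi => ?_)
        rw [abs_mul, abs_mul, abs_pow, abs_neg, abs_one, one_pow, one_mul, Nat.abs_cast]
        exact mul_le_mul_of_nonneg_left (hρle k hk i hi) (Nat.cast_nonneg _)
      have h2 : ∑ i ∈ range (2 * k + 1), ((2 * k).choose i : ℝ) * (2 * ((K : ℝ) * v) ^ J / J.factorial)
          = (2 : ℝ) ^ (2 * k) * (2 * ((K : ℝ) * v) ^ J / J.factorial) := by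
        rw [← sum_mul]
        congr 1
        have := Nat.sum_range_choose (2 * k)
        exact_mod_cast this
      have hX : 0 ≤ 2 * ((K : ℝ) * v) ^ J / J.factorial := by positivity
      calc (1 / 2 : ℝ) ^ k * |∑ i ∈ range (2 * k + 1), (-1 : ℝ) ^ i * ((2 * k).choose i : ℝ) * ρ k i|
          ≤ (1 / 2 : ℝ) ^ k * ((2 : ℝ) ^ (2 * k) * (2 * ((K : ℝ) * v) ^ J / J.factorial)) := by
            rw [← h2]; exact mul_le_mul_of_nonneg_left h1 (by positivity)
        _ = 2 ^ k * (2 * ((K : ℝ) * v) ^ J / J.factorial) := by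
            rw [pow_mul, ← mul_assoc, ← mul_pow]; norm_num
        _ ≤ 2 ^ K * (2 * ((K : ℝ) * v) ^ J / J.factorial) :=
            mul_le_mul_of_nonneg_right (pow_le_pow_right₀ (by norm_num) hk') hX
    refine (sum_le_sum hterm).trans ?_
    rw [sum_const, card_range, nsmul_eq_mul]
    push_cast
    ring_nf
    rfl
  calc |(-c) ^ (K + 1) / (1 + c) +
        ∑ k ∈ range (K + 1), (-1 / 2 : ℝ) ^ k *
          ∑ i ∈ range (2 * k + 1), (-1 : ℝ) ^ i * ((2 * k).choose i : ℝ) * ρ k i|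
      ≤ v ^ J + ((K : ℝ) + 1) * 2 ^ K * (2 * ((K : ℝ) * v) ^ J / J.factorial) :=
        (abs_add_le _ _).trans (add_le_add htail hsumle)
    _ = (1 + ((K : ℝ) + 1) * 2 ^ K * (2 * (K : ℝ) ^ J / J.factorial)) * v ^ J := by
        rw [mul_pow]; ring

/-! ## Lemma 3.1: `r(u) = e^{u/2}/(e^u − e^{−u}) − 1/(2u) = Σ_{n<N} b_n u^n + O(u^N)` -/

/-- The printed decomposition `e^{u/2}/(e^u − e^{−u}) = ½ (1/(e^{u/2} + e^{−u/2}) + 1/(e^{u/2} − e^{−u/2}))`,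
in the form `r(u) = ¼·[2/(e^v + e^{−v})] + ¼·[2/(e^v − e^{−v}) − 1/v]`, `v = u/2`.
[cite: Connes2024HeatExpansion, Lemma 3.1 proof, first display (arXiv p0006:L10)] -/
theorem heatKernel_eq_quarter (u : ℝ) (hu : 0 < u) :
    Real.exp (u / 2) / (Real.exp u - Real.exp (-u)) - 1 / (2 * u) =
      1 / 4 * (2 / (Real.exp (u / 2) + Real.exp (-(u / 2)))) +
        1 / 4 * (2 / (Real.exp (u / 2) - Real.exp (-(u / 2))) - 1 / (u / 2)) := by
  have eu : Real.exp u = Real.exp (u / 2) ^ 2 := by rw [← Real.exp_nat_mul]; ring_nf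
  have enu : Real.exp (-u) = Real.exp (-(u / 2)) ^ 2 := by rw [← Real.exp_nat_mul]; ring_nf
  rw [eu, enu, Real.exp_neg]
  set x := Real.exp (u / 2) with hx
  have hx1 : 1 < x := Real.one_lt_exp_iff.mpr (by linarith)
  have hx0 : x ≠ 0 := by positivity
  have hx2 : 1 < x ^ 2 := one_lt_pow₀ hx1 (by norm_num)
  have hx4 : 1 < x ^ 4 := one_lt_pow₀ hx1 (by norm_num)
  have h1 : x ^ 2 - 1 ≠ 0 := by linarith
  have h2 : x ^ 2 + 1 ≠ 0 := by positivity
  have h3 : x ^ 4 - 1 ≠ 0 := by linarith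
  have hu' : u ≠ 0 := hu.ne'
  have e1 : x ^ 2 - x⁻¹ ^ 2 = (x ^ 4 - 1) / x ^ 2 := by field_simp
  have e2 : x + x⁻¹ = (x ^ 2 + 1) / x := by field_simp
  have e3 : x - x⁻¹ = (x ^ 2 - 1) / x := by field_simp
  rw [e1, e2, e3]
  field_simp
  ring

/-- The coefficients `b_n = heatCoeffB n` are `¼ 2^{−n}` times the sum of the `sech` and `csch − 1/v`
coefficients (`B_{n+1} = 0` for even `n ≥ 2`). [cite: Connes2024HeatExpansion, Lemma 3.1 (arXiv p0006:L1)] -/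
theorem heatCoeffB_eq_quarter (n : ℕ) :
    heatCoeffB n = 1 / 4 * ((if Even n then ((connesEuler (n / 2) : ℚ) : ℝ) else 0) / n.factorial) / 2 ^ n +
      1 / 4 * (2 * (1 - 2 ^ n) * ((bernoulli (n + 1) : ℚ) : ℝ) / (n + 1).factorial) / 2 ^ n := by
  rw [heatCoeffB]
  rcases Nat.even_or_odd n with hev | hodd
  · rw [if_pos hev, if_pos hev]
    have hB : (1 - (2 : ℝ) ^ n) * ((bernoulli (n + 1) : ℚ) : ℝ) = 0 := by
      rcases Nat.eq_zero_or_pos n with rfl | hn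
      · simp
      · rw [bernoulli_eq_zero_of_odd (Even.add_one hev) (by omega), Rat.cast_zero, mul_zero]
    have h0 : 1 / 4 * (2 * (1 - (2 : ℝ) ^ n) * ((bernoulli (n + 1) : ℚ) : ℝ) / (n + 1).factorial) / 2 ^ n
        = 0 := by
      rw [mul_assoc (2 : ℝ), hB]; simp
    rw [h0, add_zero]
    ring
  · rw [if_neg (Nat.not_even_iff_odd.mpr hodd), if_neg (Nat.not_even_iff_odd.mpr hodd)]
    have h2 : (2 : ℝ) ^ (n + 1) ≠ 0 := pow_ne_zero _ two_ne_zero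
    have hf' : ((n + 1).factorial : ℝ) ≠ 0 := by positivity
    rw [pow_succ] at h2 ⊢
    field_simp
    ring

/-- **Connes 2024, Lemma 3.1 (as an asymptotic expansion at `0`, all orders)**: for every `N` there is `C`
with `|e^{u/2}/(e^u − e^{−u}) − 1/(2u) − Σ_{n<N} b_n u^n| ≤ C u^N` for `0 < u ≤ 1`, `b_n = heatCoeffB n`
(`b_0 = ¼`, `b_{2k−1} = −(1 − 2^{1−2k})B_{2k}/(2(2k)!)`, `b_{2k} = ¼ 2^{−2k} E(2k)/(2k)!`). The source states the
power series `r(u) = Σ b_n u^n`, `|u| < π`; this is its consequence used in Lemma 3.2.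
[cite: Connes2024HeatExpansion, Lemma 3.1 (arXiv p0006:L1–L8)] -/
theorem abs_heatKernel_sub_sum_le (N : ℕ) :
    ∃ C : ℝ, ∀ u ∈ Set.Ioc (0 : ℝ) 1,
      |Real.exp (u / 2) / (Real.exp u - Real.exp (-u)) - 1 / (2 * u) -
          ∑ n ∈ range N, heatCoeffB n * u ^ n| ≤ C * u ^ N := by
  obtain ⟨C₁, hC₁⟩ := abs_two_div_exp_add_exp_neg_sub_le N
  obtain ⟨C₂, hC₂⟩ := abs_two_div_exp_sub_exp_neg_sub_le N
  refine ⟨(C₁ + C₂) / 4 / 2 ^ N, fun u hu => ?_⟩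
  have hu0 : 0 < u := hu.1
  set v := u / 2 with hv
  have hv1 : v ∈ Set.Icc (0 : ℝ) (1 / 2) := ⟨by rw [hv]; linarith, by rw [hv]; linarith [hu.2]⟩
  have hv2 : v ∈ Set.Ioc (0 : ℝ) (1 / 2) := ⟨by rw [hv]; linarith, by rw [hv]; linarith [hu.2]⟩
  have h1 := hC₁ v hv1
  have h2 := hC₂ v hv2
  have huv : u = 2 * v := by rw [hv]; ring
  have hsum : ∑ n ∈ range N, heatCoeffB n * u ^ n =
      1 / 4 * ∑ j ∈ range N, (if Even j then ((connesEuler (j / 2) : ℚ) : ℝ) else 0) / j.factorial * v ^ j +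
        1 / 4 * ∑ m ∈ range N,
          2 * (1 - 2 ^ m) * ((bernoulli (m + 1) : ℚ) : ℝ) / (m + 1).factorial * v ^ m := by
    rw [mul_sum, mul_sum, ← sum_add_distrib]
    refine sum_congr rfl fun n _ => ?_
    rw [heatCoeffB_eq_quarter, huv, mul_pow]
    have h2 : (2 : ℝ) ^ n ≠ 0 := pow_ne_zero _ two_ne_zero
    field_simp
  rw [heatKernel_eq_quarter u hu0, hsum, ← hv]
  have e : 1 / 4 * (2 / (Real.exp v + Real.exp (-v))) + 1 / 4 * (2 / (Real.exp v - Real.exp (-v)) - 1 / v) -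
      (1 / 4 * ∑ j ∈ range N, (if Even j then ((connesEuler (j / 2) : ℚ) : ℝ) else 0) / j.factorial * v ^ j +
        1 / 4 * ∑ m ∈ range N,
          2 * (1 - 2 ^ m) * ((bernoulli (m + 1) : ℚ) : ℝ) / (m + 1).factorial * v ^ m)
      = 1 / 4 * (2 / (Real.exp v + Real.exp (-v)) -
          ∑ j ∈ range N, (if Even j then ((connesEuler (j / 2) : ℚ) : ℝ) else 0) / j.factorial * v ^ j) +
        1 / 4 * (2 / (Real.exp v - Real.exp (-v)) - 1 / v -
          ∑ m ∈ range N, 2 * (1 - 2 ^ m) * ((bernoulli (m + 1) : ℚ) : ℝ) / (m + 1).factorial * v ^ m) := by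
    ring
  rw [e]
  calc _ ≤ |1 / 4 * (2 / (Real.exp v + Real.exp (-v)) -
          ∑ j ∈ range N, (if Even j then ((connesEuler (j / 2) : ℚ) : ℝ) else 0) / j.factorial * v ^ j)| +
        |1 / 4 * (2 / (Real.exp v - Real.exp (-v)) - 1 / v -
          ∑ m ∈ range N, 2 * (1 - 2 ^ m) * ((bernoulli (m + 1) : ℚ) : ℝ) / (m + 1).factorial * v ^ m)| :=
        abs_add_le _ _
    _ ≤ 1 / 4 * (C₁ * v ^ N) + 1 / 4 * (C₂ * v ^ N) := by
        rw [abs_mul, abs_mul, abs_of_pos (by norm_num : (0 : ℝ) < 1 / 4)]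
        gcongr
    _ = (C₁ + C₂) / 4 / 2 ^ N * u ^ N := by
        rw [huv, mul_pow]
        have : (2 : ℝ) ^ N ≠ 0 := pow_ne_zero _ two_ne_zero
        field_simp

/-- Crude bound away from `0`: `|e^{u/2}/(e^u − e^{−u}) − 1/(2u)| ≤ 5/2` for `u ≥ 1`. [folklore] -/
private theorem abs_heatKernel_le {u : ℝ} (hu : 1 ≤ u) :
    |Real.exp (u / 2) / (Real.exp u - Real.exp (-u)) - 1 / (2 * u)| ≤ 5 / 2 := by
  have hu0 : 0 < u := by linarith
  have he1 : (2 : ℝ) ≤ Real.exp u := by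
    have := Real.add_one_le_exp u; linarith
  have hpos : 0 < Real.exp u - Real.exp (-u) := by
    rw [sub_pos]; exact Real.exp_lt_exp.mpr (by linarith)
  have hhalf : Real.exp (u / 2) ≤ Real.exp u := Real.exp_le_exp.mpr (by linarith)
  have hden : Real.exp u / 2 ≤ Real.exp u - Real.exp (-u) := by
    have : Real.exp (-u) ≤ 1 := by rw [Real.exp_le_one_iff]; linarith
    linarith
  have h1 : Real.exp (u / 2) / (Real.exp u - Real.exp (-u)) ≤ 2 := by
    rw [div_le_iff₀ hpos]; linarith
  have h1' : 0 ≤ Real.exp (u / 2) / (Real.exp u - Real.exp (-u)) := by positivity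
  have h2 : 1 / (2 * u) ≤ 1 / 2 := by
    rw [div_le_div_iff₀ (by positivity) (by norm_num)]; linarith
  have h2' : 0 ≤ 1 / (2 * u) := by positivity
  rw [abs_le]; constructor <;> linarith

/-- **Lemma 3.1, global form on `(0, ∞)`**: `|r(u) − Σ_{n<N} b_n u^n| ≤ C u^N` for all `u > 0` (on `[1, ∞)`
both `r` and the polynomial are `O(u^N)`). This is the remainder estimate used for Lemma 3.2.
[cite: Connes2024HeatExpansion, Lemma 3.1 and proof of Lemma 3.2 (arXiv p0006:L1, p0007)] -/
theorem abs_heatKernel_sub_sum_le_of_pos (N : ℕ) :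
    ∃ C : ℝ, ∀ u : ℝ, 0 < u →
      |Real.exp (u / 2) / (Real.exp u - Real.exp (-u)) - 1 / (2 * u) -
          ∑ n ∈ range N, heatCoeffB n * u ^ n| ≤ C * u ^ N := by
  obtain ⟨C₁, hC₁⟩ := abs_heatKernel_sub_sum_le N
  set C₂ : ℝ := 5 / 2 + ∑ n ∈ range N, |heatCoeffB n| with hC₂
  refine ⟨max C₁ C₂, fun u hu => ?_⟩
  have huN : 0 ≤ u ^ N := pow_nonneg hu.le _
  rcases le_or_gt u 1 with h | h
  · exact (hC₁ u ⟨hu, h⟩).trans (mul_le_mul_of_nonneg_right (le_max_left _ _) huN)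
  · have hu1 : 1 ≤ u := h.le
    have hpoly : |∑ n ∈ range N, heatCoeffB n * u ^ n| ≤ (∑ n ∈ range N, |heatCoeffB n|) * u ^ N := by
      rw [sum_mul]
      refine (abs_sum_le_sum_abs _ _).trans (sum_le_sum fun n hn => ?_)
      rw [abs_mul, abs_pow, abs_of_pos hu]
      exact mul_le_mul_of_nonneg_left (pow_le_pow_right₀ hu1 (mem_range.mp hn).le) (abs_nonneg _)
    have h1N : (1 : ℝ) ≤ u ^ N := one_le_pow₀ hu1
    calc |Real.exp (u / 2) / (Real.exp u - Real.exp (-u)) - 1 / (2 * u) - ∑ n ∈ range N, heatCoeffB n * u ^ n|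
        ≤ |Real.exp (u / 2) / (Real.exp u - Real.exp (-u)) - 1 / (2 * u)| +
            |∑ n ∈ range N, heatCoeffB n * u ^ n| := abs_sub _ _
      _ ≤ 5 / 2 * u ^ N + (∑ n ∈ range N, |heatCoeffB n|) * u ^ N := by
          gcongr
          · calc _ ≤ (5 / 2 : ℝ) := abs_heatKernel_le hu1
              _ = 5 / 2 * 1 := by ring
              _ ≤ 5 / 2 * u ^ N := by gcongr
      _ = C₂ * u ^ N := by rw [hC₂]; ring
      _ ≤ max C₁ C₂ * u ^ N := mul_le_mul_of_nonneg_right (le_max_right _ _) huN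

end ZetaHeatKernelTaylor

end Literature.NumberTheory.LFunctions

end
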